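import Mathlib
import HarnessLib
import Summits.CriticalPhenomena.Ising3DConformalLimit.Theses.PlantedPinning
import Summits.CriticalPhenomena.Ising3DConformalLimit.Theorems.PlantedPinningPinningEfficiencyDeficitOfSlack
import Summits.CriticalPhenomena.Ising3DConformalLimit.Theses.IsingEuclidUpgrade
import Summits.CriticalPhenomena.Ising3DConformalLimit.Theorems.LeeYangGapGaussianLimitKillsBlockCoupling
import Literature.Barriers.CriticalPhenomena.IsingTrivialityFromDimensionFour

/-!
# Strategist s2 — typed census attempts for `PlantedPinning.PinningEfficiencyDeficit`

Crux item `stmt-CriticalPhenomena-8451`, route `route-CriticalPhenomena-PlantedPinning`.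
This file is EVIDENCE for `STRATEGY-CENSUS-s2.md` (independent census, family `-s`): every
heading of the census has at least one typed attempt here.  Nothing in this file is a route
item; nothing is proposed to `Theorems/`.  All theorems are sorry-free glue showing exactly
what each switch buys (or fails to buy).

* `LiminfDeficit`, `liminfDeficit_of_deficit`, `closes_of_liminfDeficit` — §1 (weaker
  intermediate read off the summit / `closes`): the weakest lattice statement that still runs
  the route's `closes` verbatim; strictly weaker in form, identical in content.
* `NonGaussianMoebiusLimit`, `ngl_of_deficit_saturation`, `closes_of_ngl`, `ngl_of_r4` — §1:
  the only thing crux ∧ GaussianPinningSaturation contribute to `closes` is this continuum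
  statement, which is a WEAKENING of the existing item `IsingEuclidUpgradeR4NonGaussian`
  (stmt-CriticalPhenomena-0636).
* `HyperscalingFloor3`, `BlockCouplingFloor3`, `CsSlackWindow`, `SlackTransmission`,
  `deficit_of_split` — §2 (decomposition): the honest 2-piece split through the registered stub
  S1; assembly proved from the landed `pinningEfficiencyDeficit_of_csSlackWindow` (p144818); and
  the DOMINATION fact `closes_of_hyperscalingFloor3` / `closes_of_blockCouplingFloor3`: the hard
  piece D1 alone closes the summit through the landed `gaussianLimitKillsBlockCoupling_proof`
  (LeeYangGap item 4950), so the split buys nothing for the summit.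
* `critU4`, `axialSquare`, `PlanarSquareU4Floor`, `SpatialSquareU4Floor3` — §3 (transfer): the
  `d = 2` sibling theorem (Aizenman 1982 Prop. 8.1) typed, and the `d = 3` analogue it would need.
* `ScaleUniformNonGaussianity3` — §4 (strengthen): the scale-uniform non-Gaussianity S⁺ in the
  Aizenman–Duminil-Copin normalisation.
* `PinningSaturation3`, `not_deficit_of_saturation`, `saturation_of_gaussian_limit` — §5
  (negation): the counterexample statement and why it is a triviality-type theorem for `d = 3`.
-/

namespace Summit.CriticalPhenomena.Ising3DConformalLimit.Cruxes.PinningEfficiencyDeficit.StrategistS2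

open Summit.CriticalPhenomena.Ising3DConformalLimit.Theses.PlantedPinning
open Summit.CriticalPhenomena.Ising3DConformalLimit.Theses.IsingEuclidUpgrade

/-! ## §1 Weaker intermediates read off the summit -/

/-- W1 — liminf form of the deficit: SOME density `p` below every threshold and SOME
arbitrarily large `L` show efficiency `≤ 1 - ε`.  Formally weaker than the crux (∀p ∀ᶠL) and
still sufficient for `closes` because `GaussianPinningSaturation` delivers `1 - ε/2 ≤ eff`
for ALL small `p` eventually in `L`. -/
def LiminfDeficit : Prop :=
  let βc : ℝ := Literature.Probability.LatticeModels.criticalBeta 3; let M : ℕ → Literature.Probability.LatticeModels.SpinConfig (Literature.Probability.LatticeModels.Site 3) → ℝ := fun L σ => ∑ x ∈ Literature.Probability.LatticeModels.box 3 L, Literature.Probability.LatticeModels.spinAt x σ; let cvar : ℕ → Finset (Literature.Probability.LatticeModels.Site 3) → Literature.Probability.LatticeModels.SpinConfig (Literature.Probability.LatticeModels.Site 3) → ℝ := fun L P η => Literature.Probability.LatticeModels.isingExpect (Literature.Probability.LatticeModels.zdGraph 3) (Literature.Probability.LatticeModels.box 3 L \ P) βc 0 (.fixed η) (fun σ =>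 M L σ ^ 2) - Literature.Probability.LatticeModels.isingExpect (Literature.Probability.LatticeModels.zdGraph 3) (Literature.Probability.LatticeModels.box 3 L \ P) βc 0 (.fixed η) (M L) ^ 2; let pvar : ℕ → ℕ → ℝ := fun L k => (∑ P ∈ (Literature.Probability.LatticeModels.box 3 L).powersetCard k, ∑ τ : ↥(Literature.Probability.LatticeModels.box 3 L) → ℤˣ, Literature.Probability.LatticeModels.isingWeight (Literature.Probability.LatticeModels.zdGraph 3) (Literature.Probability.LatticeModels.box 3 L) βc 0 .plus τ / Literature.Probability.LatticeModels.isingPartitionFunction (Literature.Probability.LatticeModels.zdGraph 3) (Literature.Probability.LatticeModels.box 3 L) βc 0 .plus * cvar L P (Literature.Probability.LatticeModels.glue (Literature.Probability.LatticeModels.box 3 L) τ .plus)) / ((Literature.Probability.LatticeModels.box 3 L).card.choose k : ℝ); let eff : ℕ → ℕ → ℝ := fun L k => (k : ℝ) * pvar L k / ((((Literature.Probability.LatticeModels.box 3 L).card : ℝ) + 1) * (((Literature.Probability.LatticeModels.box 3 L).card : ℝ) - k + 1)); ∃ ε : ℝ, 0 < ε ∧ ∀ p₀ : ℝ, 0 <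 p₀ → ∃ p : ℝ, 0 < p ∧ p < p₀ ∧ ∀ L₀ : ℕ, ∃ L ≥ L₀, eff L ⌈p * ((Literature.Probability.LatticeModels.box 3 L).card : ℝ)⌉₊ ≤ 1 - ε

theorem liminfDeficit_of_deficit : PinningEfficiencyDeficit → LiminfDeficit := by
  intro hDef
  obtain ⟨ε, hε, p₀, hp₀, hdef⟩ := hDef
  refine ⟨ε, hε, fun p₁ hp₁ => ?_⟩
  refine ⟨min p₀ p₁ / 2, by positivity, ?_, fun L₀ => ?_⟩
  · have := min_le_right p₀ p₁
    linarith
  · have hle₀ : min p₀ p₁ ≤ p₀ := min_le_left p₀ p₁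
    have hmin : 0 < min p₀ p₁ := lt_min hp₀ hp₁
    obtain ⟨L₁, hL₁⟩ := hdef (min p₀ p₁ / 2) (by positivity) (by linarith)
    exact ⟨max L₀ L₁, le_max_left _ _, hL₁ _ (le_max_right _ _)⟩

/-- `closes` re-run from the liminf form: the route's deciding theorem needs no more than W1. -/
theorem closes_of_liminfDeficit :
    LiminfDeficit → GaussianPinningSaturation → MoebiusLimitExists → _root_.Ising3DConformalLimit := by
  intro hDef hSat hMoeb
  obtain ⟨ρ, Δ, S, hρ, hΔ, hlim, hnd, hmob⟩ := hMoeb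
  refine ⟨ρ, Δ, S, hρ, hΔ, hlim, hnd, hmob, ?_⟩
  by_contra hU4
  obtain ⟨ε, hε, hdef⟩ := hDef
  obtain ⟨p₁, hp₁, hsat⟩ := hSat ρ Δ S hρ hΔ hlim hnd hmob hU4 (ε / 2) (by linarith)
  obtain ⟨p, hp, hpp, hfreq⟩ := hdef p₁ hp₁
  obtain ⟨L₁, hL₁⟩ := hsat p hp hpp
  obtain ⟨L, hL, h₀⟩ := hfreq L₁
  have h₁ := hL₁ L hL
  linarith

/-- W2 — what crux ∧ GaussianPinningSaturation deliver to `closes`, and nothing more: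
every Möbius-covariant non-degenerate pointwise scaling limit of `criticalCorr 3` has `U₄ ≢ 0`. -/
def NonGaussianMoebiusLimit : Prop :=
  ∀ (ρ : ℝ → ℝ) (Δ : ℝ) (S : Literature.Probability.LatticeModels.CorrFamily 3),
    (∀ δ ∈ Set.Ioc (0:ℝ) 1, 0 < ρ δ) → 0 < Δ →
    Literature.Probability.LatticeModels.HasPointwiseScalingLimit
      (Literature.Probability.LatticeModels.criticalCorr 3) ρ S →
    Literature.Probability.LatticeModels.IsNondegenerateTwoPoint S →
    Literature.Probability.LatticeModels.IsMoebiusCovariant Δ S →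
    Literature.Probability.LatticeModels.HasNontrivialU4 S

theorem ngl_of_deficit_saturation :
    PinningEfficiencyDeficit → GaussianPinningSaturation → NonGaussianMoebiusLimit := by
  intro hDef hSat ρ Δ S hρ hΔ hlim hnd hmob
  by_contra hU4
  obtain ⟨ε, hε, p₀, hp₀, hdef⟩ := hDef
  obtain ⟨p₁, hp₁, hsat⟩ := hSat ρ Δ S hρ hΔ hlim hnd hmob hU4 (ε / 2) (by linarith)
  have hmin : 0 < min p₀ p₁ := lt_min hp₀ hp₁
  have hle₀ : min p₀ p₁ ≤ p₀ := min_le_left p₀ p₁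
  have hle₁ : min p₀ p₁ ≤ p₁ := min_le_right p₀ p₁
  obtain ⟨L₀, hL₀⟩ := hdef (min p₀ p₁ / 2) (by linarith) (by linarith)
  obtain ⟨L₁, hL₁⟩ := hsat (min p₀ p₁ / 2) (by linarith) (by linarith)
  have h₀ := hL₀ (max L₀ L₁) (le_max_left L₀ L₁)
  have h₁ := hL₁ (max L₀ L₁) (le_max_right L₀ L₁)
  linarith

theorem closes_of_ngl : NonGaussianMoebiusLimit → MoebiusLimitExists → _root_.Ising3DConformalLimit := by
  intro h hMoeb
  obtain ⟨ρ, Δ, S, hρ, hΔ, hlim, hnd, hmob⟩ := hMoeb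
  exact ⟨ρ, Δ, S, hρ, hΔ, hlim, hnd, hmob, h ρ Δ S hρ hΔ hlim hnd hmob⟩

/-- W2 is implied by the existing, 32-route item `IsingEuclidUpgradeR4NonGaussian`
(stmt-CriticalPhenomena-0636): replacing the crux by W2 files nothing new. -/
theorem ngl_of_r4 : IsingEuclidUpgradeR4NonGaussian → NonGaussianMoebiusLimit :=
  fun h ρ _Δ S hρ _hΔ hlim hnd _hmob => h ρ S hρ hlim hnd

/-! ## §2 Decomposition through the registered stub S1 -/

/-- D1 — lattice hyperscaling / uniform renormalised-coupling floor in `d = 3`: the block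
Binder coupling `g_L := (3Σ_L² − ⟨M_L⁴⟩⁺_{β_c})/Σ_L²` (`Σ_L = ⟨M_L²⟩⁺_{β_c}`, `M_L = Σ_{x∈Λ_L} σ_x`)
stays above a fixed `g₀ > 0` at all large scales (Lebowitz + GKS give `0 ≤ g_L ≤ 3`).  This is
the lattice-uniform form of clause (iii) of the summit — hyperscaling — proved for `d = 2`
(Aizenman 1982, Cor. 8.2), refuted for `d > 4` (ibid. Prop. 10.1), marginally refuted for `d = 4`
(Aizenman–Duminil-Copin 2021, Thm 1.2), OPEN for `d = 3`.  Spelled with the same atoms as the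
LANDED support item `LeeYangGap.GaussianLimitKillsBlockCoupling` (stmt-CriticalPhenomena-4950). -/
def HyperscalingFloor3 : Prop :=
  ∃ g₀ : ℝ, 0 < g₀ ∧ ∃ L₀ : ℕ, ∀ L ≥ L₀, g₀ ≤ (3 * (Literature.Probability.LatticeModels.plusExpect 3 (Literature.Probability.LatticeModels.criticalBeta 3) 0 (fun σ => (∑ x ∈ Literature.Probability.LatticeModels.box 3 L, Literature.Probability.LatticeModels.spinAt x σ) ^ 2)) ^ 2 - Literature.Probability.LatticeModels.plusExpect 3 (Literature.Probability.LatticeModels.criticalBeta 3) 0 (fun σ => (∑ x ∈ Literature.Probability.LatticeModels.box 3 L, Literature.Probability.LatticeModels.spinAt x σ) ^ 4)) / (Literature.Probability.LatticeModels.plusExpect 3 (Literature.Probability.LatticeModels.criticalBeta 3) 0 (fun σ => (∑ x ∈ Literature.Probability.LatticeModels.box 3 L, Literature.Probability.LatticeModels.spinAt x σ) ^ 2)) ^ 2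

/-- D1⁻ — the `limsup` form (`g_L ≥ g₀` for infinitely many `L`); weaker than D1. -/
def BlockCouplingFloor3 : Prop :=
  ∃ g₀ : ℝ, 0 < g₀ ∧ ∃ᶠ L : ℕ in Filter.atTop, g₀ ≤ (3 * (Literature.Probability.LatticeModels.plusExpect 3 (Literature.Probability.LatticeModels.criticalBeta 3) 0 (fun σ => (∑ x ∈ Literature.Probability.LatticeModels.box 3 L, Literature.Probability.LatticeModels.spinAt x σ) ^ 2)) ^ 2 - Literature.Probability.LatticeModels.plusExpect 3 (Literature.Probability.LatticeModels.criticalBeta 3) 0 (fun σ => (∑ x ∈ Literature.Probability.LatticeModels.box 3 L, Literature.Probability.LatticeModels.spinAt x σ) ^ 4)) / (Literature.Probability.LatticeModels.plusExpect 3 (Literature.Probability.LatticeModels.criticalBeta 3) 0 (fun σ => (∑ x ∈ Literature.Probability.LatticeModels.box 3 L, Literature.Probability.LatticeModels.spinAt x σ) ^ 2)) ^ 2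

theorem blockCouplingFloor3_of_hyperscalingFloor3 : HyperscalingFloor3 → BlockCouplingFloor3 := by
  rintro ⟨g₀, hg₀, L₀, hL₀⟩
  exact ⟨g₀, hg₀, Filter.Eventually.frequently (Filter.eventually_atTop.2 ⟨L₀, hL₀⟩)⟩

/-- KEY DOMINATION FACT for §2: already the limsup block-coupling floor gives W2, by the LANDED
theorem `gaussianLimitKillsBlockCoupling_proof` (route LeeYangGap, item 4950, sorry-free in
`Theorems/`) and `IsMoebiusCovariant.isScaleCovariant`.  Hence D1 closes the summit with the
route's own third hypothesis and WITHOUT the crux or `GaussianPinningSaturation`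
(`closes_of_blockCouplingFloor3`): any split of the crux whose hard piece is D1 is dominated. -/
theorem ngl_of_blockCouplingFloor3 : BlockCouplingFloor3 → NonGaussianMoebiusLimit := by
  rintro ⟨g₀, hg₀, hfreq⟩ ρ Δ S hρ _hΔ hlim hnd hmob
  by_contra hU4
  have ht :=
    Summit.CriticalPhenomena.Ising3DConformalLimit.LeeYangGapGaussianLimitKillsBlockCoupling.gaussianLimitKillsBlockCoupling_proof
      ρ Δ S hρ hlim hnd hmob.isScaleCovariant hU4
  have hev : ∀ᶠ L : ℕ in Filter.atTop, (3 * (Literature.Probability.LatticeModels.plusExpect 3 (Literature.Probability.LatticeModels.criticalBeta 3) 0 (fun σ => (∑ x ∈ Literature.Probability.LatticeModels.box 3 L, Literature.Probability.LatticeModels.spinAt x σ) ^ 2)) ^ 2 - Literature.Probability.LatticeModels.plusExpect 3 (Literature.Probability.LatticeModels.criticalBeta 3) 0 (fun σ => (∑ x ∈ Literature.Probability.LatticeModels.box 3 L, Literature.Probability.LatticeModels.spinAt x σ) ^ 4)) / (Literature.Probability.LatticeModels.plusExpect 3 (Literature.Probability.LatticeModels.criticalBeta 3) 0 (fun σ =>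 (∑ x ∈ Literature.Probability.LatticeModels.box 3 L, Literature.Probability.LatticeModels.spinAt x σ) ^ 2)) ^ 2 < g₀ / 2 :=
    ht.eventually (gt_mem_nhds (by linarith))
  obtain ⟨L, hL₁, hL₂⟩ := (hfreq.and_eventually hev).exists
  linarith

theorem closes_of_blockCouplingFloor3 :
    BlockCouplingFloor3 → MoebiusLimitExists → _root_.Ising3DConformalLimit :=
  fun h hM => closes_of_ngl (ngl_of_blockCouplingFloor3 h) hM

theorem closes_of_hyperscalingFloor3 :
    HyperscalingFloor3 → MoebiusLimitExists → _root_.Ising3DConformalLimit :=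
  fun h => closes_of_blockCouplingFloor3 (blockCouplingFloor3_of_hyperscalingFloor3 h)

/-- The registered hardest stub S1 (`stub_csSlackWindow` of `Lines/birth.lean`), verbatim as the
hypothesis of the landed composition `pinningEfficiencyDeficit_of_csSlackWindow`. -/
def CsSlackWindow : Prop :=
  (fun (βc : ℝ) (M : ℕ → Literature.Probability.LatticeModels.SpinConfig (Literature.Probability.LatticeModels.Site 3) → ℝ) => (fun (pvar csq : ℕ → ℕ → ℝ) => ∃ s : ℝ, 0 < s ∧ ∃ p₀ : ℝ, 0 < p₀ ∧ ∀ p : ℝ, 0 < p → p < p₀ → ∃ L₀ : ℕ, ∀ L ≥ L₀, ∀ j : ℕ, ⌈p * ((Literature.Probability.LatticeModels.box 3 L).card : ℝ)⌉₊ ≤ 2 * j → j < ⌈p * ((Literature.Probability.LatticeModels.box 3 L).card : ℝ)⌉₊ → (1 + s) * pvar L j ^ 2 ≤ csq L j) (fun (L k : ℕ) => (∑ P ∈ (Literature.Probability.LatticeModels.box 3 L).powersetCard k, ∑ τ : ↥(Literature.Probability.LatticeModels.box 3 L) → ℤˣ, Literature.Probability.LatticeModels.isingWeight (Literature.Probability.LatticeModels.zdGraph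 3) (Literature.Probability.LatticeModels.box 3 L) βc 0 .plus τ / Literature.Probability.LatticeModels.isingPartitionFunction (Literature.Probability.LatticeModels.zdGraph 3) (Literature.Probability.LatticeModels.box 3 L) βc 0 .plus * (Literature.Probability.LatticeModels.isingExpect (Literature.Probability.LatticeModels.zdGraph 3) (Literature.Probability.LatticeModels.box 3 L \ P) βc 0 (.fixed (Literature.Probability.LatticeModels.glue (Literature.Probability.LatticeModels.box 3 L) τ .plus)) (fun σ => M L σ ^ 2) - Literature.Probability.LatticeModels.isingExpect (Literature.Probability.LatticeModels.zdGraph 3) (Literature.Probability.LatticeModels.box 3 L \ P) βc 0 (.fixed (Literature.Probability.LatticeModels.glue (Literature.Probability.LatticeModels.box 3 L) τ .plus)) (M L) ^ 2)) / ((Literature.Probability.LatticeModels.box 3 L).card.choose k : ℝ)) (fun (L j : ℕ) => (∑ P ∈ (Literature.Probability.LatticeModels.box 3 L).powersetCard j, ∑ τ : ↥(Literature.Probability.LatticeModels.box 3 L) → ℤˣ, Literature.Probability.LatticeModels.isingWeight (Literature.Probability.LatticeModels.zdGraph 3) (Literature.Probability.LatticeModels.box 3 L) βc 0 .plus τ /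 Literature.Probability.LatticeModels.isingPartitionFunction (Literature.Probability.LatticeModels.zdGraph 3) (Literature.Probability.LatticeModels.box 3 L) βc 0 .plus * ((((Literature.Probability.LatticeModels.box 3 L).card : ℝ) - j) * ∑ z ∈ Literature.Probability.LatticeModels.box 3 L \ P, (Literature.Probability.LatticeModels.isingExpect (Literature.Probability.LatticeModels.zdGraph 3) (Literature.Probability.LatticeModels.box 3 L \ P) βc 0 (.fixed (Literature.Probability.LatticeModels.glue (Literature.Probability.LatticeModels.box 3 L) τ .plus)) (fun σ => M L σ * Literature.Probability.LatticeModels.spinAt z σ) - Literature.Probability.LatticeModels.isingExpect (Literature.Probability.LatticeModels.zdGraph 3) (Literature.Probability.LatticeModels.box 3 L \ P) βc 0 (.fixed (Literature.Probability.LatticeModels.glue (Literature.Probability.LatticeModels.box 3 L) τ .plus)) (M L) * Literature.Probability.LatticeModels.isingExpect (Literature.Probability.LatticeModels.zdGraph 3) (Literature.Probability.LatticeModels.box 3 L \ P) βc 0 (.fixed (Literature.Probability.LatticeModels.glue (Literature.Probability.LatticeModels.box 3 L) τ .plus)) (fun σ => Literature.Probability.LatticeModels.spinAt z σ)) ^ 2))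 / ((Literature.Probability.LatticeModels.box 3 L).card.choose j : ℝ))) (Literature.Probability.LatticeModels.criticalBeta 3) (fun (L : ℕ) (σ : Literature.Probability.LatticeModels.SpinConfig (Literature.Probability.LatticeModels.Site 3)) => ∑ x ∈ Literature.Probability.LatticeModels.box 3 L, Literature.Probability.LatticeModels.spinAt x σ)

/-- D2 — the transmission bridge: block-level non-Gaussianity ⇒ a uniform Cauchy–Schwarz slack
in the pinning Riccati chain at densities `j ∈ [k/2, k)`.  No argument for it is known in ANY
dimension (not even `d = 2`, where D1 is a theorem). -/
def SlackTransmission : Prop := HyperscalingFloor3 → CsSlackWindow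

/-- Assembly of the split, sorry-free, from the landed composition (p144818). -/
theorem deficit_of_split : HyperscalingFloor3 → SlackTransmission → PinningEfficiencyDeficit :=
  fun h t =>
    Summit.CriticalPhenomena.Ising3DConformalLimit.PlantedPinningDeficit.pinningEfficiencyDeficit_of_csSlackWindow
      (t h)


/-! ## §3 Transfer: the solved sibling's (`d = 2`) version of the step and its `d = 3` analogue -/

/-- The lattice Ursell function `U₄` of the critical plus-state correlators on `ℤ^d`
(pairing form; `criticalCorr d n x = ⟨∏ σ_{xᵢ}⟩⁺_{β_c(d)}`). -/
noncomputable def critU4 (d : ℕ) (x : Fin 4 → Literature.Probability.LatticeModels.Site d) : ℝ :=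
  Literature.Probability.LatticeModels.criticalCorr d 4 x -
    (Literature.Probability.LatticeModels.criticalCorr d 2 ![x 0, x 1] *
        Literature.Probability.LatticeModels.criticalCorr d 2 ![x 2, x 3] +
      Literature.Probability.LatticeModels.criticalCorr d 2 ![x 0, x 2] *
        Literature.Probability.LatticeModels.criticalCorr d 2 ![x 1, x 3] +
      Literature.Probability.LatticeModels.criticalCorr d 2 ![x 0, x 3] *
        Literature.Probability.LatticeModels.criticalCorr d 2 ![x 1, x 2])

/-- The axial "square" configuration `(r e₀, r e₁, -r e₀, -r e₁)` in `ℤ^d` (`d ≥ 2`). -/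
def axialSquare (d : ℕ) (h : 2 ≤ d) (r : ℤ) : Fin 4 → Literature.Probability.LatticeModels.Site d :=
  ![Pi.single ⟨0, by omega⟩ r, Pi.single ⟨1, by omega⟩ r,
    Pi.single ⟨0, by omega⟩ (-r), Pi.single ⟨1, by omega⟩ (-r)]

/-- T₂ — the sibling's theorem (Aizenman, CMP 86 (1982), Prop. 8.1, eq. (8.1); CDM 2020 eq. (6.7)):
in `d = 2`, for the symmetric square, `|U₄(x₁,…,x₄)| ≥ ⟨σ_{x₁}σ_{x₃}⟩⟨σ_{x₂}σ_{x₄}⟩` at every `β`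
(here at `β_c(2)`), because two planar current paths joining opposite corners MUST intersect.
A published theorem; typed here only to exhibit the shape of the transferred step. -/
def PlanarSquareU4Floor : Prop :=
  ∀ r : ℤ, 0 < r →
    Literature.Probability.LatticeModels.criticalCorr 2 2 ![axialSquare 2 le_rfl r 0, axialSquare 2 le_rfl r 2] *
        Literature.Probability.LatticeModels.criticalCorr 2 2 ![axialSquare 2 le_rfl r 1, axialSquare 2 le_rfl r 3] ≤
      |critU4 2 (axialSquare 2 le_rfl r)|

/-- T₃ — the `d = 3` analogue the transfer would need (with ANY fixed constant `c > 0` in place of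
`1`): a scale-uniform intersection floor for two critical double-current clusters with
macroscopically separated sources.  This is non-triviality of the critical 3D scaling limit in
its random-current form (Aizenman CDM 2020 §5, "we omit the case d = 3, and not by chance";
§11(1) open) — i.e. at least the content of item stmt-CriticalPhenomena-0636, not a piece of it. -/
def SpatialSquareU4Floor3 : Prop :=
  ∃ c : ℝ, 0 < c ∧ ∀ r : ℤ, 0 < r →
    c * (Literature.Probability.LatticeModels.criticalCorr 3 2
            ![axialSquare 3 (by norm_num) r 0, axialSquare 3 (by norm_num) r 2] *
          Literature.Probability.LatticeModels.criticalCorr 3 2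
            ![axialSquare 3 (by norm_num) r 1, axialSquare 3 (by norm_num) r 3]) ≤
      |critU4 3 (axialSquare 3 (by norm_num) r)|

/-! ## §4 Strengthening: scale-uniform non-Gaussianity in the ADC normalisation -/

/-- S⁺ — some compactly supported continuous test function whose normalised smeared MGF at
criticality stays a fixed distance from the Gaussian value `1` at all large scales (the exact
negation-in-form of the `d ≥ 5` / `d = 4` triviality displays of the barrier file
`IsingTrivialityFromDimensionFour`). -/
def ScaleUniformNonGaussianity3 : Prop :=
  ∃ (f : EuclideanSpace ℝ (Fin 3) → ℝ), Continuous f ∧ HasCompactSupport f ∧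
    ∃ z : ℝ, 0 < z ∧ ∃ c : ℝ, 0 < c ∧ ∃ L₀ : ℕ, ∀ L ≥ L₀,
      c ≤ |Literature.Barriers.CriticalPhenomena.criticalSmearedMGF 3 f L z - 1|


/-! ## §5 Negation: what a counterexample to the crux would have to be -/

/-- N — pinning saturation of the 3D critical Ising channel: efficiency `→ 1` as `p → 0`
(eventually in `L`).  This is the conclusion of `GaussianPinningSaturation` WITHOUT its Gaussian
hypothesis, i.e. "the planted-pinning channel of critical 3D Ising is asymptotically Gaussian";
it refutes the crux (`not_deficit_of_saturation`).  No theorem in print gives it (it is a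
triviality-type statement in `d = 3`), and the lead's numerics (evidence 2026-08-17T17:30 on the
item: `A_val ≈ 0.07 ± 0.01` flat in `L ≥ 48`; `1 − e = 0.15–0.20` flat in `L` at fixed `p`) point
the other way. -/
def PinningSaturation3 : Prop :=
  let βc : ℝ := Literature.Probability.LatticeModels.criticalBeta 3; let M : ℕ → Literature.Probability.LatticeModels.SpinConfig (Literature.Probability.LatticeModels.Site 3) → ℝ := fun L σ => ∑ x ∈ Literature.Probability.LatticeModels.box 3 L, Literature.Probability.LatticeModels.spinAt x σ; let cvar : ℕ → Finset (Literature.Probability.LatticeModels.Site 3) → Literature.Probability.LatticeModels.SpinConfig (Literature.Probability.LatticeModels.Site 3) → ℝ := fun L P η => Literature.Probability.LatticeModels.isingExpect (Literature.Probability.LatticeModels.zdGraph 3) (Literature.Probability.LatticeModels.box 3 L \ P) βc 0 (.fixed η) (fun σ => M L σ ^ 2) - Literature.Probability.LatticeModels.isingExpect (Literature.Probability.LatticeModels.zdGraph 3) (Literature.Probability.LatticeModels.box 3 L \ P) βc 0 (.fixed η) (M L) ^ 2; let pvar : ℕ → ℕ → ℝ := fun L k => (∑ P ∈ (Literature.Probability.LatticeModels.box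 3 L).powersetCard k, ∑ τ : ↥(Literature.Probability.LatticeModels.box 3 L) → ℤˣ, Literature.Probability.LatticeModels.isingWeight (Literature.Probability.LatticeModels.zdGraph 3) (Literature.Probability.LatticeModels.box 3 L) βc 0 .plus τ / Literature.Probability.LatticeModels.isingPartitionFunction (Literature.Probability.LatticeModels.zdGraph 3) (Literature.Probability.LatticeModels.box 3 L) βc 0 .plus * cvar L P (Literature.Probability.LatticeModels.glue (Literature.Probability.LatticeModels.box 3 L) τ .plus)) / ((Literature.Probability.LatticeModels.box 3 L).card.choose k : ℝ); let eff : ℕ → ℕ → ℝ := fun L k => (k : ℝ) * pvar L k / ((((Literature.Probability.LatticeModels.box 3 L).card : ℝ) + 1) * (((Literature.Probability.LatticeModels.box 3 L).card : ℝ) - k + 1)); ∀ ε : ℝ, 0 < ε → ∃ p₀ : ℝ, 0 < p₀ ∧ ∀ p : ℝ, 0 < p → p < p₀ → ∃ L₀ : ℕ, ∀ L ≥ L₀, 1 - ε ≤ eff L ⌈p * ((Literature.Probability.LatticeModels.box 3 L).card : ℝ)⌉₊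

theorem not_deficit_of_saturation : PinningSaturation3 → ¬ PinningEfficiencyDeficit := by
  intro hS hD
  obtain ⟨ε, hε, p₀, hp₀, hdef⟩ := hD
  obtain ⟨p₁, hp₁, hsat⟩ := hS (ε / 2) (by linarith)
  have hmin : 0 < min p₀ p₁ := lt_min hp₀ hp₁
  have hle₀ : min p₀ p₁ ≤ p₀ := min_le_left p₀ p₁
  have hle₁ : min p₀ p₁ ≤ p₁ := min_le_right p₀ p₁
  obtain ⟨L₀, hL₀⟩ := hdef (min p₀ p₁ / 2) (by linarith) (by linarith)
  obtain ⟨L₁, hL₁⟩ := hsat (min p₀ p₁ / 2) (by linarith) (by linarith)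
  have h₀ := hL₀ (max L₀ L₁) (le_max_left L₀ L₁)
  have h₁ := hL₁ (max L₀ L₁) (le_max_right L₀ L₁)
  linarith

/-- … and `GaussianPinningSaturation` is exactly "Gaussian Möbius limit ⇒ N", so a counterexample
to the crux obtained through the route's own mechanism needs a Gaussian (trivial) scaling limit
of critical 3D Ising — the negation of clause (iii) of the summit. -/
theorem saturation_of_gaussian_limit (hSat : GaussianPinningSaturation)
    (ρ : ℝ → ℝ) (Δ : ℝ) (S : Literature.Probability.LatticeModels.CorrFamily 3)
    (hρ : ∀ δ ∈ Set.Ioc (0:ℝ) 1, 0 < ρ δ) (hΔ : 0 < Δ)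
    (hlim : Literature.Probability.LatticeModels.HasPointwiseScalingLimit
      (Literature.Probability.LatticeModels.criticalCorr 3) ρ S)
    (hnd : Literature.Probability.LatticeModels.IsNondegenerateTwoPoint S)
    (hmob : Literature.Probability.LatticeModels.IsMoebiusCovariant Δ S)
    (hG : ¬ Literature.Probability.LatticeModels.HasNontrivialU4 S) : PinningSaturation3 :=
  fun ε hε => hSat ρ Δ S hρ hΔ hlim hnd hmob hG ε hε

end Summit.CriticalPhenomena.Ising3DConformalLimit.Cruxes.PinningEfficiencyDeficit.StrategistS2
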